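import Mathlib
import Literature.Analysis.FunctionSpaces.TorusFourierModes
import Literature.Analysis.FunctionSpaces.TorusFourierCalculus
import Literature.Analysis.FunctionSpaces.TorusFourierSynthesis
import Literature.Analysis.FunctionSpaces.TorusTestFunction
import Literature.Analysis.FunctionSpaces.TorusFluidGlueProofs
import Literature.Analysis.FunctionSpaces.TorusCalculusProofs

/-!
# Spectral and `H¹` bookkeeping for the truncated-dodger kill (negative side of
# `KolmogorovFloorEnsembleCeiling`, stmt-AnomalousDissipation-14183; also `KolmogorovFloor`, stmt-14030)

Line lead `prover-line-stmt-AnomalousDissipation-14183-0` (2026-08-16), formalising the paper theorem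
`FloorWitnessForcesDodgerRoughness` of `Cruxes/KolmogorovFloor/Ideas/truncated-euler-k41-hot.md`. Elementary
facts about smooth fields on `T^d` used by the packet bookkeeping:

* `mFourierCoeff_eq_zero_of_fourierTruncate_eq_zero` / `_of_fourierTruncate_eq_self` — reading band
  limitation / band exclusion off `P_M w = 0`, `P_K w = w`;
* `integral_inner_eq_zero_of_band_gap` — a field with no modes in the ball of radius `M` is `L²`-orthogonal
  to every field band-limited at level `N ≤ M`;
* `gradNormSq_le_of_fourierTruncate_eq_self` — Bernstein: `‖∇w‖₂² ≤ 4π²K² ∫‖w‖²` for `P_K w = w`;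
* `eq_zero_of_forall_mFourierCoeff_eq_zero` — a smooth field with vanishing coefficients vanishes;
* `gradNormSq_add_smul_le`, `integral_norm_sq_add_smul_le` — `‖∇(a + t w)‖² ≤ 2‖∇a‖² + 2t²‖∇w‖²` and the
  same for the energy;
* `two_mul_abs_integral_inner_laplacian_le` — Young's form of the viscous drift,
  `2|∫⟪a, ΔW⟫| ≤ λ‖∇a‖² + ‖∇W‖²/λ`.

Nothing here asserts a Theses statement.
-/

noncomputable section

open MeasureTheory UnitAddTorus
open scoped InnerProductSpace

namespace Summit.AnomalousDissipation.AnomalousDissipation.Theorems.KolmogorovFloorEnsembleCeiling.Negative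

open Literature.Analysis.FunctionSpaces Literature.Analysis.FunctionSpaces.Torus

variable {d : Type} [Fintype d] [DecidableEq d]

/-! ### Band limitation read off the truncation -/

/-- If `P_M w = 0` then `ŵ(k) = 0` on the ball `|k|² ≤ M²` (integrable `w`). -/
theorem mFourierCoeff_eq_zero_of_fourierTruncate_eq_zero {w : UnitAddTorus d → EuclideanSpace ℝ d}
    (hw : Integrable w volume) {M : ℕ} (h : fourierTruncate M w = 0) {k : d → ℤ} (hk : k ∈ freqBall M) :
    mFourierCoeff (EuclideanSpace.complexify ∘ w) k = 0 := by
  have h1 := mFourierCoeff_fourierTruncate hw M k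
  rw [if_pos hk, h] at h1
  rw [← h1]
  have h0 : (EuclideanSpace.complexify ∘ (0 : UnitAddTorus d → EuclideanSpace ℝ d)) = fun _ => 0 := by
    funext x
    simp
  rw [h0]
  simp [mFourierCoeff]

omit [DecidableEq d] in
/-- If `P_K w = w` for a continuous `w` then `ŵ(k) = 0` off the ball `|k|² ≤ K²`. -/
theorem mFourierCoeff_eq_zero_of_fourierTruncate_eq_self [DecidableEq d] {w : UnitAddTorus d → EuclideanSpace ℝ d}
    (hw : Continuous w) {K : ℕ} (h : fourierTruncate K w = w) {k : d → ℤ} (hk : (K : ℝ) ^ 2 < freqNormSq k) :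
    mFourierCoeff (EuclideanSpace.complexify ∘ w) k = 0 := by
  have h1 := mFourierCoeff_fourierTruncate hw.integrable_unitAddTorus K k
  rw [h, if_neg (not_mem_freqBall.2 hk)] at h1
  exact h1

/-- **Band gap orthogonality**: if `w` has no Fourier modes in the ball of radius `M` (`P_M w = 0`) and
`g` is band-limited at level `N ≤ M`, then `∫ ⟪w, g⟫ = 0`. -/
theorem integral_inner_eq_zero_of_band_gap {w g : UnitAddTorus d → EuclideanSpace ℝ d}
    (hw : Continuous w) (hg : Continuous g) {M N : ℕ} (hNM : N ≤ M) (hw0 : fourierTruncate M w = 0)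
    (hgN : ∀ k, (N : ℝ) ^ 2 < freqNormSq k → mFourierCoeff (EuclideanSpace.complexify ∘ g) k = 0) :
    ∫ x, ⟪w x, g x⟫_ℝ = 0 := by
  have hwm : MemLp w 2 volume := hw.memLp_of_hasCompactSupport (HasCompactSupport.of_compactSpace w)
  have hgm : MemLp g 2 volume := hg.memLp_of_hasCompactSupport (HasCompactSupport.of_compactSpace g)
  rw [integral_inner_eq_sum_of_band_limited hwm hgm (S := freqBall N)
    (fun k hk => hgN k (not_mem_freqBall.1 hk))]
  refine Finset.sum_eq_zero fun k hk => ?_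
  rw [mFourierCoeff_eq_zero_of_fourierTruncate_eq_zero hw.integrable_unitAddTorus hw0
    (freqBall_mono hNM hk)]
  simp

/-- The symmetric form of the band gap orthogonality: `∫ ⟪g, w⟫ = 0`. -/
theorem integral_inner_eq_zero_of_band_gap' {w g : UnitAddTorus d → EuclideanSpace ℝ d}
    (hw : Continuous w) (hg : Continuous g) {M N : ℕ} (hNM : N ≤ M) (hw0 : fourierTruncate M w = 0)
    (hgN : ∀ k, (N : ℝ) ^ 2 < freqNormSq k → mFourierCoeff (EuclideanSpace.complexify ∘ g) k = 0) :
    ∫ x, ⟪g x, w x⟫_ℝ = 0 := by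
  rw [← integral_inner_eq_zero_of_band_gap hw hg hNM hw0 hgN]
  exact integral_congr_ae (ae_of_all _ fun x => real_inner_comm _ _)

/-- **Bernstein's inequality in `L²`**: a smooth field with `P_K w = w` has `‖∇w‖₂² ≤ 4π² K² ∫ ‖w‖²`. -/
theorem gradNormSq_le_of_fourierTruncate_eq_self {w : UnitAddTorus d → EuclideanSpace ℝ d}
    (hw : IsSmooth w) {K : ℕ} (h : fourierTruncate K w = w) :
    gradNormSq w ≤ 4 * Real.pi ^ 2 * (K : ℝ) ^ 2 * ∫ x, ‖w x‖ ^ 2 := by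
  have hband : ∀ k, (K : ℝ) ^ 2 < freqNormSq k → mFourierCoeff (EuclideanSpace.complexify ∘ w) k = 0 :=
    fun k hk => mFourierCoeff_eq_zero_of_fourierTruncate_eq_self hw.continuous h hk
  have hE := eGradNormSq_eq_sum_of_band_limited hw.continuous hband
  have hL := integral_norm_sq_eq_sum_of_band_limited hw.continuous hband
  rw [gradNormSq_eq_toReal_eGradNormSq_holds hw, hE, hL, ENNReal.toReal_ofReal]
  · rw [Finset.mul_sum, Finset.mul_sum]
    refine Finset.sum_le_sum fun k hk => ?_
    have hk' : freqNormSq k ≤ (K : ℝ) ^ 2 := mem_freqBall.1 hk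
    have h0 : 0 ≤ ‖mFourierCoeff (EuclideanSpace.complexify ∘ w) k‖ ^ 2 := sq_nonneg _
    have hpi : 0 ≤ 4 * Real.pi ^ 2 := by positivity
    calc 4 * Real.pi ^ 2 * (freqNormSq k * ‖mFourierCoeff (⇑EuclideanSpace.complexify ∘ w) k‖ ^ 2)
        = 4 * Real.pi ^ 2 * freqNormSq k * ‖mFourierCoeff (⇑EuclideanSpace.complexify ∘ w) k‖ ^ 2 := by ring
      _ ≤ 4 * Real.pi ^ 2 * (K : ℝ) ^ 2 * ‖mFourierCoeff (⇑EuclideanSpace.complexify ∘ w) k‖ ^ 2 := by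
          gcongr
  · refine mul_nonneg (by positivity) (Finset.sum_nonneg fun k _ => ?_)
    exact mul_nonneg (freqNormSq_nonneg k) (sq_nonneg _)

/-- A smooth field all of whose Fourier coefficients vanish is zero. -/
theorem eq_zero_of_forall_mFourierCoeff_eq_zero {w : UnitAddTorus d → EuclideanSpace ℝ d} (hw : IsSmooth w)
    (h : ∀ k, mFourierCoeff (EuclideanSpace.complexify ∘ w) k = 0) : w = 0 := by
  have hc : IsSmooth (EuclideanSpace.complexify ∘ w) :=
    (EuclideanSpace.complexify (ι := d)).toContinuousLinearMap.contDiff.comp hw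
  have h0 : IsSmooth (EuclideanSpace.complexify ∘ (0 : UnitAddTorus d → EuclideanSpace ℝ d)) :=
    (EuclideanSpace.complexify (ι := d)).toContinuousLinearMap.contDiff.comp (isSmooth_const _)
  have heq : (EuclideanSpace.complexify ∘ w) = (EuclideanSpace.complexify ∘ (0 : UnitAddTorus d → EuclideanSpace ℝ d)) := by
    refine hc.ext_mFourierCoeff h0 fun k => ?_
    rw [h k]
    have e : (EuclideanSpace.complexify ∘ (0 : UnitAddTorus d → EuclideanSpace ℝ d)) = fun _ => 0 := by
      funext x; simp
    rw [e]
    simp [mFourierCoeff]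
  funext x
  have hx := congr_fun heq x
  simp only [Function.comp_apply, Pi.zero_apply, map_zero] at hx
  have hinj : Function.Injective (EuclideanSpace.complexify (ι := d)) := (EuclideanSpace.complexify (ι := d)).injective
  exact hinj (by rw [hx]; simp)

/-! ### `H¹` and `L²` bookkeeping for `a + t • w` -/

omit [DecidableEq d] in
/-- Pointwise: `‖p + q‖² ≤ 2‖p‖² + 2‖q‖²`. -/
theorem norm_add_sq_le_two_mul {E : Type*} [SeminormedAddCommGroup E] (p q : E) :
    ‖p + q‖ ^ 2 ≤ 2 * ‖p‖ ^ 2 + 2 * ‖q‖ ^ 2 := by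
  have h := norm_add_le p q
  have h2 : ‖p + q‖ ^ 2 ≤ (‖p‖ + ‖q‖) ^ 2 := pow_le_pow_left₀ (norm_nonneg _) h 2
  nlinarith [sq_nonneg (‖p‖ - ‖q‖)]

/-- `‖∇(a + t w)‖₂² ≤ 2 ‖∇a‖₂² + 2 t² ‖∇w‖₂²` for smooth fields. -/
theorem gradNormSq_add_smul_le {a w : UnitAddTorus d → EuclideanSpace ℝ d} (ha : IsSmooth a) (hw : IsSmooth w)
    (t : ℝ) : gradNormSq (a + t • w) ≤ 2 * gradNormSq a + 2 * t ^ 2 * gradNormSq w := by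
  have ha1 : IsContDiff 1 a := ha.isContDiff (by simp)
  have hw1 : IsContDiff 1 w := hw.isContDiff (by simp)
  have htw1 : IsContDiff 1 (t • w) := (hw.smul t).isContDiff (by simp)
  have hpd : ∀ i x, partialDeriv i (a + t • w) x = partialDeriv i a x + t • partialDeriv i w x := by
    intro i x
    rw [partialDeriv_add ha1 htw1 i, Pi.add_apply, partialDeriv_const_smul hw1 t i, Pi.smul_apply]
  have hpt : ∀ x, ∑ i, ‖partialDeriv i (a + t • w) x‖ ^ 2 ≤
      2 * (∑ i, ‖partialDeriv i a x‖ ^ 2) + 2 * t ^ 2 * ∑ i, ‖partialDeriv i w x‖ ^ 2 := by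
    intro x
    rw [Finset.mul_sum, Finset.mul_sum, ← Finset.sum_add_distrib]
    refine Finset.sum_le_sum fun i _ => ?_
    rw [hpd i x]
    have h := norm_add_sq_le_two_mul (partialDeriv i a x) (t • partialDeriv i w x)
    rw [norm_smul, mul_pow, Real.norm_eq_abs, sq_abs] at h
    linarith
  have hca : ∀ i, Continuous (partialDeriv i a) := fun i => (ha.partialDeriv i).continuous
  have hcw : ∀ i, Continuous (partialDeriv i w) := fun i => (hw.partialDeriv i).continuous
  have hcs : ∀ i, Continuous (partialDeriv i (a + t • w)) := fun i => ((ha.add (hw.smul t)).partialDeriv i).continuous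
  have hi : Integrable (fun x => ∑ i, ‖partialDeriv i (a + t • w) x‖ ^ 2) volume :=
    (continuous_finsetSum _ fun i _ => ((hcs i).norm).pow 2).integrable_unitAddTorus
  have hia : Integrable (fun x => ∑ i, ‖partialDeriv i a x‖ ^ 2) volume :=
    (continuous_finsetSum _ fun i _ => ((hca i).norm).pow 2).integrable_unitAddTorus
  have hiw : Integrable (fun x => ∑ i, ‖partialDeriv i w x‖ ^ 2) volume :=
    (continuous_finsetSum _ fun i _ => ((hcw i).norm).pow 2).integrable_unitAddTorus
  have hmono : ∫ x, ∑ i, ‖partialDeriv i (a + t • w) x‖ ^ 2 ≤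
      ∫ x, (2 * (∑ i, ‖partialDeriv i a x‖ ^ 2) + 2 * t ^ 2 * ∑ i, ‖partialDeriv i w x‖ ^ 2) :=
    integral_mono hi ((hia.const_mul 2).add (hiw.const_mul (2 * t ^ 2))) hpt
  rw [integral_add (hia.const_mul 2) (hiw.const_mul (2 * t ^ 2)), integral_const_mul, integral_const_mul] at hmono
  simpa [gradNormSq] using hmono

omit [DecidableEq d] in
/-- `∫ ‖a + t w‖² ≤ 2 ∫ ‖a‖² + 2 t² ∫ ‖w‖²` for continuous fields. -/
theorem integral_norm_sq_add_smul_le {a w : UnitAddTorus d → EuclideanSpace ℝ d} (ha : Continuous a)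
    (hw : Continuous w) (t : ℝ) :
    ∫ x, ‖(a + t • w) x‖ ^ 2 ≤ 2 * (∫ x, ‖a x‖ ^ 2) + 2 * t ^ 2 * ∫ x, ‖w x‖ ^ 2 := by
  have hpt : ∀ x, ‖(a + t • w) x‖ ^ 2 ≤ 2 * ‖a x‖ ^ 2 + 2 * t ^ 2 * ‖w x‖ ^ 2 := by
    intro x
    have h := norm_add_sq_le_two_mul (a x) (t • w x)
    rw [norm_smul, mul_pow, Real.norm_eq_abs, sq_abs] at h
    simpa [Pi.add_apply, Pi.smul_apply, mul_assoc] using h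
  have hi : Integrable (fun x => ‖(a + t • w) x‖ ^ 2) volume :=
    (((ha.add (hw.const_smul t)).norm).pow 2).integrable_unitAddTorus
  have hia : Integrable (fun x => ‖a x‖ ^ 2) volume := ((ha.norm).pow 2).integrable_unitAddTorus
  have hiw : Integrable (fun x => ‖w x‖ ^ 2) volume := ((hw.norm).pow 2).integrable_unitAddTorus
  have hmono : ∫ x, ‖(a + t • w) x‖ ^ 2 ≤ ∫ x, (2 * ‖a x‖ ^ 2 + 2 * t ^ 2 * ‖w x‖ ^ 2) :=
    integral_mono hi ((hia.const_mul 2).add (hiw.const_mul (2 * t ^ 2))) hpt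
  rw [integral_add (hia.const_mul 2) (hiw.const_mul (2 * t ^ 2)), integral_const_mul, integral_const_mul] at hmono
  exact hmono

/-! ### Young's form of the viscous drift -/

omit [DecidableEq d] in
/-- Pointwise Young: `2 |⟪p, q⟫| ≤ λ ‖p‖² + ‖q‖² / λ` for `λ > 0`. -/
theorem two_mul_abs_inner_le {E : Type*} [NormedAddCommGroup E] [InnerProductSpace ℝ E] (p q : E) {lam : ℝ}
    (hlam : 0 < lam) : 2 * |⟪p, q⟫_ℝ| ≤ lam * ‖p‖ ^ 2 + ‖q‖ ^ 2 / lam := by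
  have h1 : |⟪p, q⟫_ℝ| ≤ ‖p‖ * ‖q‖ := abs_real_inner_le_norm p q
  have h2 : 2 * (‖p‖ * ‖q‖) ≤ lam * ‖p‖ ^ 2 + ‖q‖ ^ 2 / lam := by
    have hsq : 0 ≤ (lam * ‖p‖ - ‖q‖) ^ 2 / lam := div_nonneg (sq_nonneg _) hlam.le
    have e : (lam * ‖p‖ - ‖q‖) ^ 2 / lam = lam * ‖p‖ ^ 2 + ‖q‖ ^ 2 / lam - 2 * (‖p‖ * ‖q‖) := by
      field_simp
      ring
    linarith [hsq, e]
  linarith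

/-- **The viscous drift, Young's form.** For smooth fields `a`, `W` on `T^d` and `λ > 0`,
`2 |∫ ⟪a, ΔW⟫| ≤ λ ‖∇a‖₂² + ‖∇W‖₂² / λ` (Green's identity `∫⟪a, ΔW⟫ = -∑ᵢ ∫⟪∂ᵢa, ∂ᵢW⟫`). -/
theorem two_mul_abs_integral_inner_laplacian_le {a W : UnitAddTorus d → EuclideanSpace ℝ d} (ha : IsSmooth a)
    (hW : IsSmooth W) {lam : ℝ} (hlam : 0 < lam) :
    2 * |∫ x, ⟪a x, laplacian W x⟫_ℝ| ≤ lam * gradNormSq a + gradNormSq W / lam := by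
  -- Green
  have hgreen : ∫ x, ⟪a x, laplacian W x⟫_ℝ = -∑ i, ∫ x, ⟪partialDeriv i a x, partialDeriv i W x⟫_ℝ := by
    have e : ∫ x, ⟪a x, laplacian W x⟫_ℝ = ∫ x, ⟪laplacian W x, a x⟫_ℝ :=
      integral_congr_ae (ae_of_all _ fun x => real_inner_comm _ _)
    rw [e]
    simp_rw [laplacian_eq_sum_partialDeriv_partialDeriv hW, sum_inner]
    rw [integral_finsetSum _ fun i _ => (((hW.partialDeriv i).partialDeriv i).inner ha).integrable,
      ← Finset.sum_neg_distrib]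
    refine Finset.sum_congr rfl fun i _ => ?_
    rw [integral_inner_partialDeriv_eq_neg (hW.partialDeriv i) ha i]
    congr 1
    exact integral_congr_ae (ae_of_all _ fun x => real_inner_comm _ _)
  rw [hgreen, abs_neg]
  -- termwise Young
  have hca : ∀ i, Continuous (partialDeriv i a) := fun i => (ha.partialDeriv i).continuous
  have hcW : ∀ i, Continuous (partialDeriv i W) := fun i => (hW.partialDeriv i).continuous
  have hterm : ∀ i, 2 * |∫ x, ⟪partialDeriv i a x, partialDeriv i W x⟫_ℝ| ≤
      lam * (∫ x, ‖partialDeriv i a x‖ ^ 2) + (∫ x, ‖partialDeriv i W x‖ ^ 2) / lam := by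
    intro i
    have h1 : |∫ x, ⟪partialDeriv i a x, partialDeriv i W x⟫_ℝ| ≤ ∫ x, |⟪partialDeriv i a x, partialDeriv i W x⟫_ℝ| :=
      abs_integral_le_integral_abs
    have hc0 : Continuous fun x => |⟪partialDeriv i a x, partialDeriv i W x⟫_ℝ| := ((hca i).inner (hcW i)).abs
    have hc1 : Continuous fun x => ‖partialDeriv i a x‖ ^ 2 := (hca i).norm.pow 2
    have hc2 : Continuous fun x => ‖partialDeriv i W x‖ ^ 2 := (hcW i).norm.pow 2
    have hi1 : Integrable (fun x => |⟪partialDeriv i a x, partialDeriv i W x⟫_ℝ|) volume := hc0.integrable_unitAddTorus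
    have hia2 : Integrable (fun x => lam * ‖partialDeriv i a x‖ ^ 2) volume := hc1.integrable_unitAddTorus.const_mul lam
    have hiW2 : Integrable (fun x => ‖partialDeriv i W x‖ ^ 2 / lam) volume := hc2.integrable_unitAddTorus.div_const lam
    have h2 : ∫ x, 2 * |⟪partialDeriv i a x, partialDeriv i W x⟫_ℝ| ≤
        ∫ x, (lam * ‖partialDeriv i a x‖ ^ 2 + ‖partialDeriv i W x‖ ^ 2 / lam) :=
      integral_mono (hi1.const_mul 2) (hia2.add hiW2) fun x => two_mul_abs_inner_le _ _ hlam
    rw [integral_const_mul, integral_add hia2 hiW2, integral_const_mul, integral_div] at h2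
    linarith
  have hsum : 2 * |∑ i, ∫ x, ⟪partialDeriv i a x, partialDeriv i W x⟫_ℝ| ≤
      ∑ i, (lam * (∫ x, ‖partialDeriv i a x‖ ^ 2) + (∫ x, ‖partialDeriv i W x‖ ^ 2) / lam) := by
    calc 2 * |∑ i, ∫ x, ⟪partialDeriv i a x, partialDeriv i W x⟫_ℝ|
        ≤ 2 * ∑ i, |∫ x, ⟪partialDeriv i a x, partialDeriv i W x⟫_ℝ| := by
          gcongr
          exact Finset.abs_sum_le_sum_abs _ _
      _ = ∑ i, 2 * |∫ x, ⟪partialDeriv i a x, partialDeriv i W x⟫_ℝ| := by rw [Finset.mul_sum]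
      _ ≤ _ := Finset.sum_le_sum fun i _ => hterm i
  -- reassemble the gradient norms
  have hga : gradNormSq a = ∑ i, ∫ x, ‖partialDeriv i a x‖ ^ 2 := by
    unfold gradNormSq
    exact integral_finsetSum _ fun i _ => (show Continuous fun x => ‖partialDeriv i a x‖ ^ 2 from
      (hca i).norm.pow 2).integrable_unitAddTorus
  have hgW : gradNormSq W = ∑ i, ∫ x, ‖partialDeriv i W x‖ ^ 2 := by
    unfold gradNormSq
    exact integral_finsetSum _ fun i _ => (show Continuous fun x => ‖partialDeriv i W x‖ ^ 2 from
      (hcW i).norm.pow 2).integrable_unitAddTorus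
  have hsplit : lam * gradNormSq a + gradNormSq W / lam =
      ∑ i, (lam * (∫ x, ‖partialDeriv i a x‖ ^ 2) + (∫ x, ‖partialDeriv i W x‖ ^ 2) / lam) := by
    rw [hga, hgW, Finset.mul_sum, Finset.sum_div, ← Finset.sum_add_distrib]
  rw [hsplit]
  exact hsum

end Summit.AnomalousDissipation.AnomalousDissipation.Theorems.KolmogorovFloorEnsembleCeiling.Negative
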